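import Mathlib.MeasureTheory.Measure.Lebesgue.EqHaar
import Literature.NumberTheory.Transcendental.KZProductIdeal
import Literature.NumberTheory.Transcendental.KZLogCalculusProofs
import Literature.NumberTheory.Transcendental.KZCubicalCalculus
import Literature.NumberTheory.Transcendental.SemialgebraicLineDeriv

/-!
# The pyramid decomposition of the unit square and Newton–Leibniz on the triangle (crux `DilationTransfer`, stmt-KontsevichZagierPeriods-3572)

Support file for crux `DilationTransfer`
(`Summit.KontsevichZagierPeriods.KontsevichZagierPeriods.Theses.LiftingCriteria.DilationTransfer`,
route `LiftingCriteria`, line `birth`, reshape 4). For a HOMOGENEOUS functional relation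
`m₀ + Σ mᵢ v_{gᵢ}(ϖ) ≡ 0` among dilation functions of integrands on the SQUARE, the dilation
structure reduces the fibre dimension by one: `∫_{[0,s]²} k = 0` for all `s` says that the
symmetrisation `κ = k + k∘σ` of `k` has vanishing integrals over the horizontal slices
`{s} × [0,s]` of the triangle `{0 ≤ t ≤ s ≤ 1}`. This file proves the two moves of the
Kontsevich–Zagier calculus that implement this reduction (all four rules are now available to the
line, after reshape 4):

* `square_pyramid` — **the square is two triangles, and the upper one is the lower one reflected**:
  for every representation `A` on `[0,1]²` there is a representation `T` on the lower triangle
  `P = {y ∈ [0,1]² | y₁ ≤ y₀}` with integrand `y ↦ A(y) + A(y∘σ)` (`σ` the swap) and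
  `[A] − [T] ∈ KZ.relations`: domain additivity (the diagonal is Lebesgue-null,
  `volume_setOf_apply_zero_eq_apply_one`), the coordinate swap as a change-of-variables move
  (`KZ.of_sub_of_reindex_mem_relations`), integrand additivity on `P`.
* `triangle_newtonLeibniz` — **Newton–Leibniz on the triangle**: `P` is the band
  `{(s,t) | s ∈ [0,1], 0 ≤ t ≤ s}` over the base `[0,1]` with semialgebraic bounds `0 ≤ s`, so a
  `ℚ`-semialgebraic fibrewise primitive `R` of the integrand of `T` (continuous on the closed
  fibres, differentiable inside) gives `[T] − [[0,1], s ↦ R(s,s) − R(s,0)] ∈ KZ.relations`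
  (Kontsevich–Zagier's rule (3) verbatim, `KZ.newtonLeibnizRel`).

## References
* M. Kontsevich, D. Zagier, *Periods* (2001), §1.2 (rules (1)–(3)).
-/

noncomputable section

open scoped BigOperators
open MeasureTheory Set
open Literature.NumberTheory.Transcendental
open Literature.ModelTheory.ExponentialFields (IsSemialgebraic isSemialgebraic_setOf_eval_le)

namespace Summit.KontsevichZagierPeriods.LiftingCriteria.DilationTransfer

/-! ### The two triangles of the unit square -/

/-- The lower triangle `{y ∈ [0,1]² | y₁ ≤ y₀}` is `ℚ`-semialgebraic. [cite: BochnakCosteRoy1998, §2.1] -/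
theorem isSemialgebraic_lowerTriangle :
    IsSemialgebraic ℚ {y : Fin 2 → ℝ | y ∈ KZ.cube 2 ∧ y 1 ≤ y 0} := by
  have h := isSemialgebraic_setOf_eval_le (k := ℚ) (R := ℝ)
    (MvPolynomial.X (1 : Fin 2)) (MvPolynomial.X (0 : Fin 2))
  simp only [MvPolynomial.aeval_X] at h
  exact KZ.isSemialgebraic_cube.inter h

/-- The upper triangle `{y ∈ [0,1]² | y₀ ≤ y₁}` is `ℚ`-semialgebraic. [cite: BochnakCosteRoy1998, §2.1] -/
theorem isSemialgebraic_upperTriangle :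
    IsSemialgebraic ℚ {y : Fin 2 → ℝ | y ∈ KZ.cube 2 ∧ y 0 ≤ y 1} := by
  have h := isSemialgebraic_setOf_eval_le (k := ℚ) (R := ℝ)
    (MvPolynomial.X (0 : Fin 2)) (MvPolynomial.X (1 : Fin 2))
  simp only [MvPolynomial.aeval_X] at h
  exact KZ.isSemialgebraic_cube.inter h

/-- The diagonal `{y₀ = y₁}` of the plane is Lebesgue-null (a proper linear subspace).
[folklore] -/
theorem volume_setOf_apply_zero_eq_apply_one :
    volume {y : Fin 2 → ℝ | y 0 = y 1} = 0 := by
  let L : (Fin 2 → ℝ) →ₗ[ℝ] ℝ :=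
    (LinearMap.proj (R := ℝ) (φ := fun _ : Fin 2 => ℝ) 0) - (LinearMap.proj (R := ℝ) (φ := fun _ : Fin 2 => ℝ) 1)
  have hker : {y : Fin 2 → ℝ | y 0 = y 1} = (LinearMap.ker L : Set (Fin 2 → ℝ)) := by
    ext y
    simp [L, sub_eq_zero]
  have hne : LinearMap.ker L ≠ ⊤ := by
    intro h
    have hmem : (fun i : Fin 2 => if i = 0 then (1:ℝ) else 0) ∈ LinearMap.ker L := by
      rw [h]; exact Submodule.mem_top
    simp [L] at hmem
  rw [hker]
  exact Measure.addHaar_submodule volume _ hne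

/-- **The pyramid decomposition of the square.** For every representation `A` on the closed unit
square there is a representation `T` on the lower triangle `{y ∈ [0,1]² | y₁ ≤ y₀}` with integrand
`y ↦ A(y) + A(y ∘ σ)` (`σ` the coordinate swap) such that `[A] − [T] ∈ KZ.relations`: domain
additivity along the null diagonal, the swap as a change of variables
(`KZ.of_sub_of_reindex_mem_relations`), and integrand additivity on the triangle.
[cite: KontsevichZagier2001, §1.2 rules (1), (2)] -/
theorem square_pyramid (A : KZ.IntegralRep 2) (hA : A.domain = KZ.cube 2) :
    ∃ T : KZ.IntegralRep 2, T.domain = {y : Fin 2 → ℝ | y ∈ KZ.cube 2 ∧ y 1 ≤ y 0} ∧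
      (∀ y, T.integrand y = A.integrand y + A.integrand (fun i => y (Equiv.swap (0 : Fin 2) 1 i))) ∧
      KZ.of A - KZ.of T ∈ KZ.relations := by
  set P₁ : Set (Fin 2 → ℝ) := {y | y ∈ KZ.cube 2 ∧ y 1 ≤ y 0} with hP₁
  set P₂ : Set (Fin 2 → ℝ) := {y | y ∈ KZ.cube 2 ∧ y 0 ≤ y 1} with hP₂
  have hP₁s : IsSemialgebraic ℚ P₁ := isSemialgebraic_lowerTriangle
  have hP₂s : IsSemialgebraic ℚ P₂ := isSemialgebraic_upperTriangle
  have hP₁A : P₁ ⊆ A.domain := fun y hy => by rw [hA]; exact hy.1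
  have hP₂A : P₂ ⊆ A.domain := fun y hy => by rw [hA]; exact hy.1
  set A₁ := A.restrict P₁ hP₁s hP₁A with hA₁
  set A₂ := A.restrict P₂ hP₂s hP₂A with hA₂
  -- (1) domain additivity along the null diagonal
  have hdom : A.domain = A₁.domain ∪ A₂.domain := by
    rw [hA]
    ext y
    simp only [hA₁, hA₂, KZ.IntegralRep.domain_restrict, hP₁, hP₂, mem_union, mem_setOf_eq]
    constructor
    · intro hy
      rcases le_total (y 1) (y 0) with h | h
      · exact Or.inl ⟨hy, h⟩
      · exact Or.inr ⟨hy, h⟩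
    · rintro (h | h)
      · exact h.1
      · exact h.1
  have hvol : volume (A₁.domain ∩ A₂.domain) = 0 := by
    refine measure_mono_null (fun y hy => ?_) volume_setOf_apply_zero_eq_apply_one
    simp only [hA₁, hA₂, KZ.IntegralRep.domain_restrict, hP₁, hP₂, mem_inter_iff, mem_setOf_eq] at hy
    exact le_antisymm hy.2.2 hy.1.2
  have hadd : KZ.of A - KZ.of A₁ - KZ.of A₂ ∈ KZ.domainAddRel :=
    ⟨2, A, A₁, A₂, hdom, hvol, fun _ _ => rfl, fun _ _ => rfl, rfl⟩
  -- (2) the upper triangle is the lower one reflected: a change of variables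
  set A₂' := A₂.reindex (Equiv.swap (0 : Fin 2) 1) with hA₂'
  have hre : KZ.of A₂ - KZ.of A₂' ∈ KZ.relations := KZ.of_sub_of_reindex_mem_relations A₂ _
  have hA₂'d : A₂'.domain = P₁ := by
    ext w
    simp only [hA₂', hA₂, KZ.IntegralRep.reindex_domain, KZ.IntegralRep.domain_restrict, hP₁, hP₂,
      mem_setOf_eq, KZ.mem_cube, Fin.forall_fin_two, Equiv.swap_apply_left, Equiv.swap_apply_right]
    tauto
  -- (3) integrand additivity on the lower triangle
  have hs₁ : IsSemialgebraicFunOn ℚ P₁ A.integrand := A₁.isSemialgebraicFunOn_integrand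
  have hs₂ : IsSemialgebraicFunOn ℚ P₁ (fun w => A.integrand (fun i => w (Equiv.swap (0 : Fin 2) 1 i))) := by
    have h := A₂'.isSemialgebraicFunOn_integrand
    rwa [hA₂'d] at h
  have hi₁ : IntegrableOn A.integrand P₁ := A₁.integrableOn
  have hi₂ : IntegrableOn (fun w => A.integrand (fun i => w (Equiv.swap (0 : Fin 2) 1 i))) P₁ := by
    have h := A₂'.integrableOn
    rwa [hA₂'d] at h
  let T : KZ.IntegralRep 2 :=
    { domain := P₁
      integrand := fun y => A.integrand y + A.integrand (fun i => y (Equiv.swap (0 : Fin 2) 1 i))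
      isSemialgebraic_domain := hP₁s
      isSemialgebraicFunOn_integrand := hs₁.fun_add hs₂
      integrableOn := hi₁.add hi₂ }
  have hiadd : KZ.of T - KZ.of A₁ - KZ.of A₂' ∈ KZ.integrandAddRel :=
    ⟨2, T, A₁, A₂', rfl, hA₂'d, fun _ _ => rfl, rfl⟩
  refine ⟨T, rfl, fun _ => rfl, ?_⟩
  have e : KZ.of A - KZ.of T =
      (KZ.of A - KZ.of A₁ - KZ.of A₂) + (KZ.of A₂ - KZ.of A₂') - (KZ.of T - KZ.of A₁ - KZ.of A₂') := by
    abel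
  rw [e]
  exact KZ.relations.sub_mem
    (KZ.relations.add_mem (KZ.domainAddRel_subset_relations hadd) hre)
    (KZ.integrandAddRel_subset_relations hiadd)

/-! ### Newton–Leibniz on the triangle -/

/-- **Newton–Leibniz on the lower triangle.** The triangle `{y ∈ [0,1]² | y₁ ≤ y₀}` is the band
over the base `[0,1]` (coordinate `0`) with bounds `0 ≤ y₁ ≤ y₀`; if `R` is `ℚ`-semialgebraic on
the triangle, continuous on each closed fibre `{s} × [0,s]` and differentiable on its interior with
derivative the integrand of `T`, then `[T] − [Z] ∈ KZ.relations` for every representation `Z` on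
`[0,1]` with integrand `s ↦ R(s,s) − R(s,0)` there.
[cite: KontsevichZagier2001, §1.2 rule (3)] -/
theorem triangle_newtonLeibniz {T : KZ.IntegralRep 2}
    (hT : T.domain = {y : Fin 2 → ℝ | y ∈ KZ.cube 2 ∧ y 1 ≤ y 0}) {R : (Fin 2 → ℝ) → ℝ}
    (hRs : IsSemialgebraicFunOn ℚ {y : Fin 2 → ℝ | y ∈ KZ.cube 2 ∧ y 1 ≤ y 0} R)
    (hRc : ∀ x ∈ KZ.cube 1, ContinuousOn (fun t : ℝ => R (Fin.snoc x t)) (Set.Icc 0 (x 0)))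
    (hRd : ∀ x ∈ KZ.cube 1, ∀ t ∈ Set.Ioo 0 (x 0),
      HasDerivAt (fun s : ℝ => R (Fin.snoc x s)) (T.integrand (Fin.snoc x t)) t)
    (Z : KZ.IntegralRep 1) (hZd : Z.domain = KZ.cube 1)
    (hZi : ∀ x ∈ KZ.cube 1, Z.integrand x = R (Fin.snoc x (x 0)) - R (Fin.snoc x 0)) :
    KZ.of T - KZ.of Z ∈ KZ.relations := by
  refine KZ.newtonLeibnizRel_subset_relations
    ⟨1, T, Z, fun _ => 0, fun x => x 0, R, ?_, ?_, ?_, ?_, ?_, ?_, ?_, ?_, rfl⟩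
  · rw [hT]; exact hRs
  · rw [hZd]; simpa using isSemialgebraicFunOn_const_natCast (KZ.isSemialgebraic_cube (n := 1)) 0
  · rw [hZd]; exact isSemialgebraicFunOn_apply KZ.isSemialgebraic_cube 0
  · intro x hx
    rw [hZd] at hx
    exact (KZ.mem_cube.1 hx 0).1
  · rw [hT, hZd]
    ext z
    simp only [mem_setOf_eq, KZ.mem_cube, Fin.forall_fin_two, Fin.forall_fin_one]
    have h0 : Fin.init z 0 = z 0 := rfl
    have h1 : z (Fin.last 1) = z 1 := rfl
    simp only [h0, h1]
    constructor
    · rintro ⟨⟨h00, h01⟩, h10⟩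
      exact ⟨h00, h01.1, h10⟩
    · rintro ⟨h00, h01, h10⟩
      exact ⟨⟨h00, h01, h10.trans h00.2⟩, h10⟩
  · intro x hx
    rw [hZd] at hx
    exact hRc x hx
  · intro x hx t ht
    rw [hZd] at hx
    exact hRd x hx t ht
  · intro x hx
    rw [hZd] at hx
    exact hZi x hx

/-- **The pyramid decomposition of the square** (closed form of `square_pyramid`, quantifiers in
front): every representation on `[0,1]²` is congruent modulo `KZ.relations` to the representation of
its symmetrised integrand on the lower triangle. [cite: KontsevichZagier2001, §1.2 rules (1), (2)] -/
theorem square_pyramid_closed :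
    ∀ (A : Literature.NumberTheory.Transcendental.KZ.IntegralRep 2), A.domain = Literature.NumberTheory.Transcendental.KZ.cube 2 → ∃ T : Literature.NumberTheory.Transcendental.KZ.IntegralRep 2, T.domain = {y : Fin 2 → ℝ | y ∈ Literature.NumberTheory.Transcendental.KZ.cube 2 ∧ y 1 ≤ y 0} ∧ (∀ y, T.integrand y = A.integrand y + A.integrand (fun i => y (Equiv.swap (0 : Fin 2) 1 i))) ∧ Literature.NumberTheory.Transcendental.KZ.of A - Literature.NumberTheory.Transcendental.KZ.of T ∈ Literature.NumberTheory.Transcendental.KZ.relations :=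
  fun A hA => square_pyramid A hA

end Summit.KontsevichZagierPeriods.LiftingCriteria.DilationTransfer
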